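/-
Copyright (c) 2026. All rights reserved.
Released under Apache 2.0 license as described in the file LICENSE.
Authors: abc-iut cell, seat abc-iut-w5-d024 (gen 5).
-/
import Literature.GroupTheory.ProfiniteSchurZassenhaus
import Literature.GroupTheory.ProfiniteSchurZassenhausConjugacy
import Literature.GroupTheory.NormalGenerationOfComplementedKernel
import Literature.GroupTheory.ProfiniteConjugateIndex

/-!
# Splitting a profinite group over a pro-`p` normal subgroup with pro-`p′`-by-procyclic quotient,
# and finite normal generation of the kernel

Let `G` be a profinite group with closed normal subgroups `P ≤ G₁` such that

* (`hP`, `hQ`) inside the profinite group `G₁`, the subgroup `P` is pro-`p` with pro-`p′` quotient: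
  in every finite continuous quotient of `G₁` the image of `P` is a `p`-group of index prime to `p`;
* (`hgen`) `G ⧸ G₁` is procyclic: some `ψ₀ ∈ G` together with `G₁` topologically generates `G`;
* (`hfree`) `G ⧸ G₁` is FREE procyclic, in the form: a procyclic closed subgroup `cl⟨ψ⟩` which together
  with `G₁` generates `G` meets `G₁` trivially.

(The model: `G = Γ_F` the absolute Galois group of a `p`-adic field, `G₁ = I_F` the inertia group,
`P = P_F` the wild inertia group: `I_F ⧸ P_F ≅ ∏_{ℓ ≠ p} ℤ_ℓ(1)` is pro-`p′`, `Γ_F ⧸ I_F ≅ Ẑ`.)  Then: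

* `sup_normalizer_eq_top_of_closed_complement` — FRATTINI ARGUMENT: for a closed complement `C` of
  `P` in `G₁`, `G = P · N_G(C)` (every `g C g⁻¹` is a closed complement of `P` in `G₁`, hence
  `G₁`-conjugate to `C` by the profinite Schur–Zassenhaus conjugacy theorem
  `exists_conj_eq_of_closed_isComplement'`);
* **`exists_closed_complement_of_procyclic_quotient`** — SPLITTING: there is a closed subgroup `H ≤ G`
  with `H ∩ P = 1` and `H P = G` (`H = C · cl⟨n⟩` for `n ∈ N_G(C)` with `ψ₀ ∈ P n`);
* **`exists_normalGenerators_of_procyclic_quotient`** — if moreover `G` is topologically finitely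
  generated, then `P` is topologically generated by the `G`-conjugates of a finite subset
  (`Literature.GroupTheory.exists_normalGenerators_of_closed_complement`).

The last statement is the input «the wild inertia group is topologically finitely normally generated»
of the elementary (bounded-width) route to the strong completeness of `Γ_F` (abc-iut cell, GAP row
G-L3d2g2-1 / fact F-1977 at `Γ_F`), reduced here to the tame structure of `Γ_F` and its topological
finite generation.  Classical profinite group theory [cite: RibesZalesskii2010, Thm 2.3.15]; universe
`0` (that of the tree's finite Schur–Zassenhaus conjugacy theorem); no definitions; nothing here
concerns [IUTchIII] Cor. 3.12.
-/

open scoped Pointwise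

namespace Literature.GroupTheory

open Subgroup ProfiniteConjugateIndex

/-! ### Complements inside a normal subgroup: transport to the subgroup type -/

section Algebra

variable {G : Type*} [Group G]

/-- Transport: `C ≤ G₁` with `C ⊓ P = ⊥`, `C ⊔ P = G₁` gives a complement of `P ∩ G₁` in the group `G₁`.
[folklore] -/
private theorem isComplement'_subgroupOf (P G₁ C : Subgroup G) [P.Normal] (hPG₁ : P ≤ G₁)
    (hCG₁ : C ≤ G₁) (hinf : C ⊓ P = ⊥) (hsup : C ⊔ P = G₁) :
    IsComplement' (P.subgroupOf G₁) (C.subgroupOf G₁) := by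
  haveI : (P.subgroupOf G₁).Normal := inferInstance
  have hdis : Disjoint (P.subgroupOf G₁) (C.subgroupOf G₁) := by
    rw [disjoint_iff, Subgroup.subgroupOf, Subgroup.subgroupOf, ← Subgroup.comap_inf, inf_comm, hinf]
    exact Subgroup.bot_subgroupOf G₁
  have hsup' : P.subgroupOf G₁ ⊔ C.subgroupOf G₁ = ⊤ := by
    rw [← Subgroup.subgroupOf_sup hPG₁ hCG₁, sup_comm, hsup, Subgroup.subgroupOf_self]
  refine isComplement'_of_disjoint_and_mul_eq_univ hdis ?_
  rw [← Subgroup.normal_mul, hsup', Subgroup.coe_top]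

/-- Conjugation on the subgroup type is conjugation. [folklore] -/
private theorem map_subtype_map_conj (G₁ : Subgroup G) (K : Subgroup G₁) (y : G₁) :
    (K.map (MulAut.conj y).toMonoidHom).map G₁.subtype =
      (K.map G₁.subtype).map (MulAut.conj (y : G)).toMonoidHom := by
  rw [Subgroup.map_map, Subgroup.map_map]
  congr 1

end Algebra

section Profinite

variable {G : Type} [Group G] [TopologicalSpace G] [IsTopologicalGroup G] [CompactSpace G]
  [T2Space G] [TotallyDisconnectedSpace G]

/-! ### Normalizers of closed subgroups -/

omit [T2Space G] in
/-- In a profinite group the normalizer of a closed subgroup is closed: it is the set of `g` with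
`g C g⁻¹ ⊆ C` (`Literature.GroupTheory.ProfiniteConjugateIndex.mem_normalizer_of_conj_mem`).
[cite: RibesZalesskii2010, §2.1 (closed subgroups of profinite groups)] -/
theorem isClosed_normalizer_of_isClosed (C : Subgroup G) (hCc : IsClosed (C : Set G)) :
    IsClosed ((normalizer (C : Set G) : Subgroup G) : Set G) := by
  have heq : ((normalizer (C : Set G) : Subgroup G) : Set G) =
      ⋂ c ∈ C, (fun g : G => g * c * g⁻¹) ⁻¹' (C : Set G) := by
    ext g
    simp only [SetLike.mem_coe, Set.mem_iInter, Set.mem_preimage]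
    constructor
    · intro hg c hc
      exact (Subgroup.mem_normalizer_iff.mp hg c).mp hc
    · intro hg
      exact mem_normalizer_of_conj_mem C hCc g hg
  rw [heq]
  exact isClosed_biInter fun c _ => hCc.preimage (by fun_prop)

/-! ### The Frattini argument -/

/-- **Frattini argument.** Let `P ≤ G₁` be closed normal subgroups of the profinite group `G`, with `P`
pro-`p` and `G₁ ⧸ P` pro-`p′` (levelwise in `G₁`), and let `C ≤ G₁` be a closed complement of `P` in
`G₁`. Then `G = P · N_G(C)`: for `g ∈ G` the closed complement `g C g⁻¹` of `P` in `G₁` is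
`G₁`-conjugate to `C` (profinite Schur–Zassenhaus conjugacy). [cite: RibesZalesskii2010, Thm 2.3.15] -/
theorem sup_normalizer_eq_top_of_closed_complement {p : ℕ} [Fact p.Prime] (P G₁ : Subgroup G)
    [P.Normal] [G₁.Normal] (hPc : IsClosed (P : Set G)) (hG₁c : IsClosed (G₁ : Set G)) (hPG₁ : P ≤ G₁)
    (hP : ∀ W : OpenNormalSubgroup G₁,
      IsPGroup p ((P.subgroupOf G₁).map (QuotientGroup.mk' (W : Subgroup G₁))))
    (hQ : ∀ W : OpenNormalSubgroup G₁,
      Nat.Coprime p ((P.subgroupOf G₁).map (QuotientGroup.mk' (W : Subgroup G₁))).index)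
    (C : Subgroup G) (hCc : IsClosed (C : Set G)) (hCG₁ : C ≤ G₁) (hinf : C ⊓ P = ⊥)
    (hsup : C ⊔ P = G₁) :
    (P : Set G) * ((normalizer (C : Set G) : Subgroup G) : Set G) = Set.univ := by
  classical
  haveI : CompactSpace G₁ := isCompact_iff_compactSpace.mp hG₁c.isCompact
  have hP₁c : IsClosed ((P.subgroupOf G₁ : Subgroup G₁) : Set G₁) :=
    hPc.preimage continuous_subtype_val
  have hC₁c : IsClosed ((C.subgroupOf G₁ : Subgroup G₁) : Set G₁) :=
    hCc.preimage continuous_subtype_val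
  have hC₁ := isComplement'_subgroupOf P G₁ C hPG₁ hCG₁ hinf hsup
  refine Set.eq_univ_iff_forall.mpr fun g => ?_
  -- the conjugate complement `g C g⁻¹ ≤ G₁`
  set C' : Subgroup G := C.map (MulAut.conj g).toMonoidHom with hC'
  have hC'c : IsClosed (C' : Set G) := by
    rw [hC', Subgroup.coe_map]
    exact (hCc.isCompact.image (by fun_prop : Continuous fun x : G => g * x * g⁻¹)).isClosed
  have hC'G₁ : C' ≤ G₁ := by
    rintro _ ⟨c, hc, rfl⟩
    exact (inferInstance : G₁.Normal).conj_mem c (hCG₁ hc) g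
  have hinj : Function.Injective (MulAut.conj g).toMonoidHom := fun a b h => (MulAut.conj g).injective h
  have hPconj : P.map (MulAut.conj g).toMonoidHom = P := by
    ext y
    constructor
    · rintro ⟨z, hz, rfl⟩
      exact (inferInstance : P.Normal).conj_mem z hz g
    · intro hy
      exact ⟨g⁻¹ * y * g⁻¹⁻¹, (inferInstance : P.Normal).conj_mem y hy g⁻¹,
        by simp [MulAut.conj_apply, mul_assoc]⟩
  have hG₁conj : G₁.map (MulAut.conj g).toMonoidHom = G₁ := by
    ext y
    constructor
    · rintro ⟨z, hz, rfl⟩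
      exact (inferInstance : G₁.Normal).conj_mem z hz g
    · intro hy
      exact ⟨g⁻¹ * y * g⁻¹⁻¹, (inferInstance : G₁.Normal).conj_mem y hy g⁻¹,
        by simp [MulAut.conj_apply, mul_assoc]⟩
  have hinf' : C' ⊓ P = ⊥ := by
    rw [hC', ← hPconj, ← Subgroup.map_inf_eq _ _ _ hinj, hinf, Subgroup.map_bot]
  have hsup' : C' ⊔ P = G₁ := by
    rw [hC', ← hPconj, ← Subgroup.map_sup, hsup, hG₁conj]
  have hC'₁c : IsClosed ((C'.subgroupOf G₁ : Subgroup G₁) : Set G₁) :=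
    hC'c.preimage continuous_subtype_val
  have hC'₁ := isComplement'_subgroupOf P G₁ C' hPG₁ hC'G₁ hinf' hsup'
  -- Schur–Zassenhaus conjugacy in `G₁`
  obtain ⟨y, hy⟩ := exists_conj_eq_of_closed_isComplement' (P.subgroupOf G₁) hP₁c hP hQ hC₁c hC'₁c
    hC₁ hC'₁
  -- back in `G`: `g C g⁻¹ = y C y⁻¹`
  have hCC' : C' = C.map (MulAut.conj (y : G)).toMonoidHom := by
    have h1 : (C'.subgroupOf G₁).map G₁.subtype = C' := by
      rw [Subgroup.subgroupOf_map_subtype]; exact inf_eq_left.mpr hC'G₁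
    have h2 : (C.subgroupOf G₁).map G₁.subtype = C := by
      rw [Subgroup.subgroupOf_map_subtype]; exact inf_eq_left.mpr hCG₁
    rw [← h1, hy, map_subtype_map_conj, h2]
  -- hence `n := y⁻¹ g` normalises `C`
  have hn : (y : G)⁻¹ * g ∈ normalizer (C : Set G) := by
    refine mem_normalizer_of_conj_mem C hCc _ fun c hc => ?_
    have hgc : g * c * g⁻¹ ∈ C' := ⟨c, hc, rfl⟩
    rw [hCC'] at hgc
    obtain ⟨c₀, hc₀, hc₀e⟩ := hgc
    have hc₀e' : (y : G) * c₀ * (y : G)⁻¹ = g * c * g⁻¹ := by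
      simpa [MulAut.conj_apply] using hc₀e
    have : (y : G)⁻¹ * g * c * ((y : G)⁻¹ * g)⁻¹ = c₀ := by
      rw [show (y : G)⁻¹ * g * c * ((y : G)⁻¹ * g)⁻¹ = (y : G)⁻¹ * (g * c * g⁻¹) * (y : G) by group,
        ← hc₀e']
      group
    rw [this]
    exact hc₀
  -- `g = y n` with `y ∈ G₁ = P C`
  have hyG₁ : (y : G) ∈ ((P ⊔ C : Subgroup G) : Set G) := by
    rw [sup_comm, hsup]; exact y.2
  rw [Subgroup.normal_mul] at hyG₁
  obtain ⟨q, hq, c, hc, hqc⟩ := Set.mem_mul.mp hyG₁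
  refine Set.mem_mul.mpr ⟨q, hq, c * ((y : G)⁻¹ * g), ?_, ?_⟩
  · exact mul_mem (Subgroup.le_normalizer hc) hn
  · rw [← mul_assoc, hqc, mul_inv_cancel_left]

/-! ### Splitting over a free procyclic quotient -/

/-- **Existence of a closed complement of `P` in `G₁`** (profinite Schur–Zassenhaus in the group `G₁`,
transported to subgroups of `G`). [cite: RibesZalesskii2010, Thm 2.3.15] -/
theorem exists_closed_complement_in {p : ℕ} [Fact p.Prime] (P G₁ : Subgroup G) [P.Normal]
    (hPc : IsClosed (P : Set G)) (hG₁c : IsClosed (G₁ : Set G)) (hPG₁ : P ≤ G₁)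
    (hP : ∀ W : OpenNormalSubgroup G₁,
      IsPGroup p ((P.subgroupOf G₁).map (QuotientGroup.mk' (W : Subgroup G₁))))
    (hQ : ∀ W : OpenNormalSubgroup G₁,
      Nat.Coprime p ((P.subgroupOf G₁).map (QuotientGroup.mk' (W : Subgroup G₁))).index) :
    ∃ C : Subgroup G, IsClosed (C : Set G) ∧ C ≤ G₁ ∧ C ⊓ P = ⊥ ∧ C ⊔ P = G₁ := by
  classical
  haveI : CompactSpace G₁ := isCompact_iff_compactSpace.mp hG₁c.isCompact
  have hP₁c : IsClosed ((P.subgroupOf G₁ : Subgroup G₁) : Set G₁) :=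
    hPc.preimage continuous_subtype_val
  obtain ⟨C₁, hC₁c, hC₁⟩ :=
    exists_closed_isComplement'_of_isPGroup_of_coprime_index (P.subgroupOf G₁) hP₁c hP hQ
  refine ⟨C₁.map G₁.subtype, ?_, Subgroup.map_subtype_le C₁, ?_, ?_⟩
  · rw [Subgroup.coe_map]
    exact hG₁c.isClosedEmbedding_subtypeVal.isClosedMap _ hC₁c
  · rw [eq_bot_iff]
    rintro x ⟨⟨c, hc, rfl⟩, hxP⟩
    have hcP : c ∈ P.subgroupOf G₁ := Subgroup.mem_subgroupOf.mpr hxP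
    have hdis := hC₁.disjoint
    rw [disjoint_iff] at hdis
    have : c ∈ P.subgroupOf G₁ ⊓ C₁ := ⟨hcP, hc⟩
    rw [hdis, Subgroup.mem_bot] at this
    rw [this]
    exact (Subgroup.mem_bot).mpr rfl
  · refine le_antisymm (sup_le (Subgroup.map_subtype_le C₁) hPG₁) fun g hg => ?_
    have hmem : (⟨g, hg⟩ : G₁) ∈ (((P.subgroupOf G₁ ⊔ C₁ : Subgroup G₁)) : Set G₁) := by
      rw [hC₁.sup_eq_top]; exact Subgroup.mem_top _
    rw [Subgroup.normal_mul] at hmem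
    obtain ⟨q, hq, c, hc, hqc⟩ := Set.mem_mul.mp hmem
    have : g = (q : G) * (c : G) := by
      have := congrArg Subtype.val hqc
      simpa using this.symm
    rw [this]
    exact mul_mem (mem_sup_right (Subgroup.mem_subgroupOf.mp hq)) (mem_sup_left ⟨c, hc, rfl⟩)

/-- **Splitting theorem.** Let `P ≤ G₁` be closed normal subgroups of the profinite group `G` with `P`
pro-`p` and `G₁ ⧸ P` pro-`p′` (levelwise in `G₁`), `G ⧸ G₁` procyclic (`hgen`) and free (`hfree`: a
procyclic closed subgroup supplementing `G₁` meets it trivially). Then `P` has a CLOSED COMPLEMENT in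
`G`: a closed `H ≤ G` with `H ⊓ P = ⊥` and `H ⊔ P = ⊤`. (Schur–Zassenhaus complement `C` of `P` in `G₁`,
Frattini argument `G = P · N_G(C)`, a procyclic lift `cl⟨n⟩ ≤ N_G(C)` of the generator of `G ⧸ G₁`, and
`H = C · cl⟨n⟩`.) [cite: RibesZalesskii2010, Thm 2.3.15] -/
theorem exists_closed_complement_of_procyclic_quotient {p : ℕ} [Fact p.Prime] (P G₁ : Subgroup G)
    [P.Normal] [G₁.Normal] (hPc : IsClosed (P : Set G)) (hG₁c : IsClosed (G₁ : Set G)) (hPG₁ : P ≤ G₁)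
    (hP : ∀ W : OpenNormalSubgroup G₁,
      IsPGroup p ((P.subgroupOf G₁).map (QuotientGroup.mk' (W : Subgroup G₁))))
    (hQ : ∀ W : OpenNormalSubgroup G₁,
      Nat.Coprime p ((P.subgroupOf G₁).map (QuotientGroup.mk' (W : Subgroup G₁))).index)
    (hgen : ∃ ψ₀ : G, (Subgroup.zpowers ψ₀).topologicalClosure ⊔ G₁ = ⊤)
    (hfree : ∀ ψ : G, (Subgroup.zpowers ψ).topologicalClosure ⊔ G₁ = ⊤ →
      (Subgroup.zpowers ψ).topologicalClosure ⊓ G₁ = ⊥) :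
    ∃ H : Subgroup G, IsClosed (H : Set G) ∧ H ⊓ P = ⊥ ∧ H ⊔ P = ⊤ := by
  classical
  obtain ⟨C, hCc, hCG₁, hinf, hsup⟩ := exists_closed_complement_in P G₁ hPc hG₁c hPG₁ hP hQ
  have hfrat := sup_normalizer_eq_top_of_closed_complement P G₁ hPc hG₁c hPG₁ hP hQ C hCc hCG₁ hinf hsup
  obtain ⟨ψ₀, hψ₀⟩ := hgen
  -- `ψ₀ = q n` with `q ∈ P`, `n ∈ N_G(C)`
  obtain ⟨q, hq, n, hn, hqn⟩ := Set.mem_mul.mp (hfrat ▸ Set.mem_univ ψ₀ :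
    ψ₀ ∈ (P : Set G) * ((normalizer (C : Set G) : Subgroup G) : Set G))
  set Ψ : Subgroup G := (Subgroup.zpowers n).topologicalClosure with hΨ
  have hΨc : IsClosed (Ψ : Set G) := Subgroup.isClosed_topologicalClosure _
  -- `Ψ ⊔ G₁ = ⊤`
  have hΨG₁c : IsClosed (((Ψ ⊔ G₁ : Subgroup G)) : Set G) := by
    rw [Subgroup.mul_normal]
    exact (hΨc.isCompact.mul hG₁c.isCompact).isClosed
  have hΨsup : Ψ ⊔ G₁ = ⊤ := by
    rw [eq_top_iff, ← hψ₀]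
    refine sup_le ?_ le_sup_right
    refine Subgroup.topologicalClosure_minimal _ ?_ hΨG₁c
    rw [Subgroup.zpowers_le, ← hqn]
    exact mul_mem (mem_sup_right (hPG₁ hq)) (mem_sup_left (Subgroup.le_topologicalClosure _
      (Subgroup.mem_zpowers n)))
  have hΨinf : Ψ ⊓ G₁ = ⊥ := hfree n hΨsup
  -- `Ψ ≤ N_G(C)`
  have hΨN : Ψ ≤ normalizer (C : Set G) :=
    Subgroup.topologicalClosure_minimal _ ((Subgroup.zpowers_le).mpr hn)
      (isClosed_normalizer_of_isClosed C hCc)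
  -- `H = C Ψ`
  refine ⟨C ⊔ Ψ, ?_, ?_, ?_⟩
  · rw [Subgroup.coe_mul_of_right_le_normalizer_left C Ψ hΨN]
    exact (hCc.isCompact.mul hΨc.isCompact).isClosed
  · rw [eq_bot_iff]
    rintro x ⟨hxH, hxP⟩
    have hx : x ∈ ((C ⊔ Ψ : Subgroup G) : Set G) := hxH
    rw [Subgroup.coe_mul_of_right_le_normalizer_left C Ψ hΨN] at hx
    obtain ⟨c, hc, ψ, hψ, rfl⟩ := Set.mem_mul.mp hx
    have hψG₁ : ψ ∈ G₁ := by
      have := mul_mem (inv_mem (hCG₁ hc)) (hPG₁ hxP)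
      rwa [inv_mul_cancel_left] at this
    have hψ1 : ψ = 1 := by
      have : ψ ∈ Ψ ⊓ G₁ := ⟨hψ, hψG₁⟩
      rw [hΨinf] at this
      exact this
    rw [hψ1, mul_one] at hxP ⊢
    have : c ∈ C ⊓ P := ⟨hc, hxP⟩
    rw [hinf] at this
    exact this
  · rw [sup_right_comm, hsup, sup_comm, hΨsup]

/-- **Finite normal generation of the kernel.** Under the hypotheses of
`exists_closed_complement_of_procyclic_quotient`, if `G` is moreover topologically finitely generated,
then `P` is topologically generated by the `G`-conjugates of a finite subset `E ⊆ P` (the input «wild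
inertia is topologically finitely normally generated» of the bounded-width route to the strong
completeness of `Γ_F`, obtained from `Γ_F` t.f.g. + the tame structure).
[cite: RibesZalesskii2010, Thm 2.3.15] -/
theorem exists_normalGenerators_of_procyclic_quotient {p : ℕ} [Fact p.Prime]
    (hG : Literature.AnabelianGeometry.AbsoluteAnabelian.IsTopologicallyFinitelyGenerated G)
    (P G₁ : Subgroup G) [P.Normal] [G₁.Normal] (hPc : IsClosed (P : Set G))
    (hG₁c : IsClosed (G₁ : Set G)) (hPG₁ : P ≤ G₁)
    (hP : ∀ W : OpenNormalSubgroup G₁,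
      IsPGroup p ((P.subgroupOf G₁).map (QuotientGroup.mk' (W : Subgroup G₁))))
    (hQ : ∀ W : OpenNormalSubgroup G₁,
      Nat.Coprime p ((P.subgroupOf G₁).map (QuotientGroup.mk' (W : Subgroup G₁))).index)
    (hgen : ∃ ψ₀ : G, (Subgroup.zpowers ψ₀).topologicalClosure ⊔ G₁ = ⊤)
    (hfree : ∀ ψ : G, (Subgroup.zpowers ψ).topologicalClosure ⊔ G₁ = ⊤ →
      (Subgroup.zpowers ψ).topologicalClosure ⊓ G₁ = ⊥) :
    ∃ E : Finset G, (E : Set G) ⊆ P ∧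
      P ≤ (Subgroup.closure {y : G | ∃ g : G, ∃ e ∈ E, y = g * e * g⁻¹}).topologicalClosure := by
  obtain ⟨H, hHc, hHinf, hHsup⟩ :=
    exists_closed_complement_of_procyclic_quotient P G₁ hPc hG₁c hPG₁ hP hQ hgen hfree
  exact exists_normalGenerators_of_closed_complement hG P H hPc hHc hHsup hHinf

end Profinite

end Literature.GroupTheory
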